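import Mathlib
import Summits.ResolutionOfSingularities.ResolutionOfSingularities.Theorems.HomologicalConductorPersistenceEtaleAscent
import Literature.RingTheory.CohomologyAnnihilator.Localization
import Literature.RingTheory.CohomologyAnnihilator.LocalGlobal
import HarnessLib

set_option linter.dupNamespace false

/-!
# Standard-étale ascent of cohomology annihilators (same index)

`[OURS · L1 w44b · ORDER w44b-o5 (res-L1-w44b-plan-1, CRUX-PLAN v7 §3) · idea-2 ROUND4-ASCENT (2.1)/(2.2)]`
— helper for the crux `HomologicalConductor.Persistence` (stmt-ResolutionOfSingularities-16484) and
its surface rung `PersistenceSurface` (stmt-ResolutionOfSingularities-19970).  NOT a statement of the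
manuscript under adjudication in cell res-hironaka; nothing here is attributed to its author.  Pure
commutative algebra over Mathlib and the tree's `Literature.RingTheory.CohomologyAnnihilator` library
([IyengarTakahashi2014] Def. 2.1, Lemma 2.10) plus idea-2's monogenic brick
`aeval_derivative_mul_mem_cohomologyAnnihilatorOfDegree` (p501192).

Write `caⁿ(R)` for `cohomologyAnnihilatorOfDegree R n` and `ca(R) = ⋃ₙ caⁿ(R)`.  Throughout the index
is the SAME on both sides (`n = d + 1 ≥ 1`; no `+ dim` shift).

* **(SE-1) monogenic + unit derivative.** `P` noetherian, `B` module-finite projective over `P`,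
  generated by `θ` with `g(θ) = 0`; `C` a localisation of `B` in which `g'(θ)` becomes a unit.  Then
  `caᵈ⁺¹(P) C ⊆ caᵈ⁺¹(C)` (`map_cohomologyAnnihilatorOfDegree_le_of_monogenic_of_isUnit`): by p501192
  `g'(θ) c ∈ caᵈ⁺¹(B)`, push to `C` by [IyengarTakahashi2014, 2.10(1)] (tree
  `map_cohomologyAnnihilatorOfDegree_le_of_isLocalization`), cancel the unit.
* **(SE-2) standard étale.** `g` monic, `B = AdjoinRoot g = P[X]/(g)` (free of finite rank, generated by
  the class of `X`), `C` any localisation of `B` inverting `g'`: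
  `map_cohomologyAnnihilatorOfDegree_le_standardEtale`; for Mathlib's `StandardEtalePair`
  (`Q.Ring ≃ (P[X]/f)[1/g]`, `f'` invertible there): `map_cohomologyAnnihilatorOfDegree_le_standardEtalePair`.
* **(SE-3) full `ca`.** `ca(P) C ⊆ ca(C)` in each setting (`map_cohomologyAnnihilator_le_…`); all degrees
  `n` at once via `map_cohomologyAnnihilatorOfDegree_le_of_forall_succ` (`ca⁰` of a nontrivial ring is `⊥`).
* **(SE-4) Mathlib's class `Algebra.IsStandardEtale P S`.** `caᵈ⁺¹(P) S ⊆ caᵈ⁺¹(S)`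
  (`map_cohomologyAnnihilatorOfDegree_le_of_isStandardEtale`), transported along the presentation
  isomorphism (`caⁿ` is invariant under ring isomorphisms, tree `map_ringEquiv_cohomologyAnnihilatorOfDegree`).
* **(SE-5) étale algebras and étale neighbourhoods.** For `S` ÉTALE over noetherian `P`
  (`Algebra.Etale P S`): `caᵈ⁺¹(P) S ⊆ caᵈ⁺¹(S)` (`map_cohomologyAnnihilatorOfDegree_le_of_etale`) — Zariski
  locally `S` is standard étale (Mathlib `Algebra.IsEtaleAt.exists_isStandardEtale`, Stacks 00UE), and
  membership in `caᵈ⁺¹(S)` is tested at the maximal ideals with the same index (tree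
  `mem_cohomologyAnnihilatorOfDegree_of_forall_isMaximal`); and for every localisation `S'` of such an
  `S` (an ÉTALE NEIGHBOURHOOD `P → (S)_𝔮`): `caᵈ⁺¹(P) S' ⊆ caᵈ⁺¹(S')`
  (`map_cohomologyAnnihilatorOfDegree_le_of_isLocalization_of_etale`).  This is idea-2's (2.2); the
  henselisation step (2.3) (filtered colimit of étale neighbourhoods) is NOT in this file.

## References

* S. B. Iyengar, R. Takahashi, *Annihilation of cohomology and strong generation of module
  categories*, IMRN 2016; arXiv:1404.1476 — Def. 2.1, Lemma 2.10, Lemma 3.3, Prop. 3.4.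
  [`IyengarTakahashi2014`]
* The Stacks project, Tag 00UE (étale ring maps are Zariski-locally standard étale) — via Mathlib
  `Algebra.IsEtaleAt.exists_isStandardEtale`.
-/

noncomputable section

open scoped Polynomial
open Polynomial (aeval derivative)

universe u

namespace Summit.ResolutionOfSingularities.ResolutionOfSingularities.Theorems.HomologicalConductor.PersistenceStandardEtaleAscent

open Literature.RingTheory.CohomologyAnnihilator
open Summit.ResolutionOfSingularities.ResolutionOfSingularities.Theorems.HomologicalConductor.PersistenceEtaleAscent

/-! ## Two pieces of bookkeeping -/

/-- `caⁿ` in ALL degrees from the positive degrees: if `caᵈ⁺¹(P) C ⊆ caᵈ⁺¹(C)` for every `d`, then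
`caⁿ(P) C ⊆ caⁿ(C)` for every `n` — in degree `0`, `ca⁰(P) = ⊥` when `P` is nontrivial (it kills
`Hom_P(P, P)`), and `C` is the zero ring when `P` is. [folklore] -/
theorem map_cohomologyAnnihilatorOfDegree_le_of_forall_succ {P C : Type u} [CommRing P] [CommRing C]
    [Algebra P C]
    (h : ∀ d : ℕ, (cohomologyAnnihilatorOfDegree P (d + 1)).map (algebraMap P C) ≤
      cohomologyAnnihilatorOfDegree C (d + 1)) (n : ℕ) :
    (cohomologyAnnihilatorOfDegree P n).map (algebraMap P C) ≤ cohomologyAnnihilatorOfDegree C n := by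
  cases n with
  | succ d => exact h d
  | zero =>
    rcases subsingleton_or_nontrivial P with hP | hP
    · haveI : Subsingleton C := (algebraMap P C).codomain_trivial
      exact le_of_eq (Subsingleton.elim _ _)
    · rw [cohomologyAnnihilatorOfDegree_zero, Ideal.map_bot]
      exact bot_le

/-- From `caⁿ(P) C ⊆ caⁿ(C)` in all positive degrees to `ca(P) C ⊆ ca(C)`: an element of `caⁿ(P)`
lies in `caⁿ⁺¹(P)`, whose image lies in `caⁿ⁺¹(C) ⊆ ca(C)`. [folklore] -/
theorem map_cohomologyAnnihilator_le_of_forall_succ {P C : Type u} [CommRing P] [CommRing C]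
    [Algebra P C]
    (h : ∀ d : ℕ, (cohomologyAnnihilatorOfDegree P (d + 1)).map (algebraMap P C) ≤
      cohomologyAnnihilatorOfDegree C (d + 1)) :
    (cohomologyAnnihilator P).map (algebraMap P C) ≤ cohomologyAnnihilator C := by
  rw [Ideal.map_le_iff_le_comap]
  intro c hc
  rw [Ideal.mem_comap]
  obtain ⟨n, hn⟩ := mem_cohomologyAnnihilator_iff.mp hc
  have hn' : c ∈ cohomologyAnnihilatorOfDegree P (n + 1) :=
    cohomologyAnnihilatorOfDegree_mono (Nat.le_succ n) hn
  exact cohomologyAnnihilatorOfDegree_le (n + 1) (h n (Ideal.mem_map_of_mem _ hn'))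

/-- Transport of an ascent statement along a `P`-algebra isomorphism `e : S ≃ₐ[P] C`: if
`caⁿ(P) C ⊆ caⁿ(C)` then `caⁿ(P) S ⊆ caⁿ(S)` (`caⁿ` is invariant under ring isomorphisms, tree
`map_ringEquiv_cohomologyAnnihilatorOfDegree`). [folklore] -/
theorem map_cohomologyAnnihilatorOfDegree_le_of_algEquiv {P S C : Type u} [CommRing P] [CommRing S]
    [CommRing C] [Algebra P S] [Algebra P C] (e : S ≃ₐ[P] C) {n : ℕ}
    (h : (cohomologyAnnihilatorOfDegree P n).map (algebraMap P C) ≤ cohomologyAnnihilatorOfDegree C n) :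
    (cohomologyAnnihilatorOfDegree P n).map (algebraMap P S) ≤ cohomologyAnnihilatorOfDegree S n := by
  have hcomp : algebraMap P S = (e.symm.toRingEquiv : C →+* S).comp (algebraMap P C) := by
    ext x
    simp
  rw [hcomp, ← Ideal.map_map]
  refine (Ideal.map_mono h).trans ?_
  rw [map_ringEquiv_cohomologyAnnihilatorOfDegree e.symm.toRingEquiv n]

/-! ## (SE-1) A monogenic free extension followed by a localisation inverting `g'(θ)` -/

section Monogenic

variable {P : Type u} [CommRing P] {B : Type u} [CommRing B] [Algebra P B]
  {C : Type u} [CommRing C] [Algebra B C] [Algebra P C] [IsScalarTower P B C]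

/-- **(SE-1), elementwise (OURS).** `P` noetherian; `B` module-finite and projective over `P`, generated
as a `P`-algebra by `θ` with `g(θ) = 0` (`g ∈ P[X]`); `C` a localisation of `B` (at any submonoid `S`)
in which `g'(θ)` is a unit. Then `c ∈ caᵈ⁺¹(P)` implies `c ∈ caᵈ⁺¹(C)`: `g'(θ)·c ∈ caᵈ⁺¹(B)` by the
monogenic brick of p501192, its image lies in `caᵈ⁺¹(C)` by [IyengarTakahashi2014, Lemma 2.10(1)] (`B`
is noetherian, being module-finite over `P`), and ideals absorb units. [OURS · L1 w44b · w44b-o5] -/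
theorem algebraMap_mem_cohomologyAnnihilatorOfDegree_of_monogenic_of_isUnit [IsNoetherianRing P]
    [Module.Finite P B] [Module.Projective P B] (θ : B) {g : P[X]} (hg : aeval θ g = 0)
    (hθ : ∀ b : B, ∃ h : P[X], b = aeval θ h) (S : Submonoid B) [IsLocalization S C]
    (hunit : IsUnit (algebraMap B C (aeval θ (derivative g)))) {d : ℕ} {c : P}
    (hc : c ∈ cohomologyAnnihilatorOfDegree P (d + 1)) :
    algebraMap P C c ∈ cohomologyAnnihilatorOfDegree C (d + 1) := by
  haveI : IsNoetherianRing B := isNoetherian_of_tower P inferInstance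
  have h1 := aeval_derivative_mul_mem_cohomologyAnnihilatorOfDegree θ hg hθ hc
  have h2 : algebraMap B C (aeval θ (derivative g) * algebraMap P B c) ∈
      cohomologyAnnihilatorOfDegree C (d + 1) :=
    map_cohomologyAnnihilatorOfDegree_le_of_isLocalization S C (d + 1) (Ideal.mem_map_of_mem _ h1)
  rw [map_mul, ← IsScalarTower.algebraMap_apply] at h2
  obtain ⟨v, hv⟩ := hunit
  rw [← hv] at h2
  have h3 := Ideal.mul_mem_left _ (↑v⁻¹ : C) h2
  rwa [← mul_assoc, Units.inv_mul, one_mul] at h3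

/-- **(SE-1) (OURS).** In the setting of
`algebraMap_mem_cohomologyAnnihilatorOfDegree_of_monogenic_of_isUnit`:
`caᵈ⁺¹(P) C ⊆ caᵈ⁺¹(C)` for every `d`. [OURS · L1 w44b · w44b-o5] -/
theorem map_cohomologyAnnihilatorOfDegree_le_of_monogenic_of_isUnit [IsNoetherianRing P]
    [Module.Finite P B] [Module.Projective P B] (θ : B) {g : P[X]} (hg : aeval θ g = 0)
    (hθ : ∀ b : B, ∃ h : P[X], b = aeval θ h) (S : Submonoid B) [IsLocalization S C]
    (hunit : IsUnit (algebraMap B C (aeval θ (derivative g)))) :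
    ∀ d : ℕ, (cohomologyAnnihilatorOfDegree P (d + 1)).map (algebraMap P C) ≤
      cohomologyAnnihilatorOfDegree C (d + 1) :=
  fun _ => Ideal.map_le_iff_le_comap.mpr fun _ hc =>
    algebraMap_mem_cohomologyAnnihilatorOfDegree_of_monogenic_of_isUnit θ hg hθ S hunit hc

/-- **(SE-3) for the monogenic setting (OURS):** `ca(P) C ⊆ ca(C)`. [OURS · L1 w44b · w44b-o5] -/
theorem map_cohomologyAnnihilator_le_of_monogenic_of_isUnit [IsNoetherianRing P]
    [Module.Finite P B] [Module.Projective P B] (θ : B) {g : P[X]} (hg : aeval θ g = 0)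
    (hθ : ∀ b : B, ∃ h : P[X], b = aeval θ h) (S : Submonoid B) [IsLocalization S C]
    (hunit : IsUnit (algebraMap B C (aeval θ (derivative g)))) :
    (cohomologyAnnihilator P).map (algebraMap P C) ≤ cohomologyAnnihilator C :=
  map_cohomologyAnnihilator_le_of_forall_succ
    (map_cohomologyAnnihilatorOfDegree_le_of_monogenic_of_isUnit θ hg hθ S hunit)

end Monogenic

/-! ## (SE-2) The standard-étale instance `B = P[X]/(g)`, `g` monic -/

section AdjoinRoot

variable {P : Type u} [CommRing P]

/-- Every element of `AdjoinRoot g = P[X]/(g)` is a polynomial in the class of `X`. [folklore] -/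
theorem exists_eq_aeval_root (g : P[X]) (b : AdjoinRoot g) :
    ∃ h : P[X], b = aeval (AdjoinRoot.root g) h := by
  obtain ⟨h, rfl⟩ := AdjoinRoot.mk_surjective b
  exact ⟨h, (AdjoinRoot.aeval_eq h).symm⟩

variable {g : P[X]} {C : Type u} [CommRing C] [Algebra (AdjoinRoot g) C] [Algebra P C]
  [IsScalarTower P (AdjoinRoot g) C]

/-- **(SE-2) standard-étale ascent (OURS).** `P` noetherian, `g ∈ P[X]` MONIC, `B = AdjoinRoot g =
P[X]/(g)` (free of finite rank over `P`, generated by the root class `θ`, `g(θ) = 0`), `C` any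
localisation of `B` in which `g'(θ)` is a unit — i.e. `C = (P[X]/(g))_h` standard étale, or a further
localisation of one. Then `caᵈ⁺¹(P) C ⊆ caᵈ⁺¹(C)` for every `d` (same index).
[OURS · L1 w44b · w44b-o5] -/
theorem map_cohomologyAnnihilatorOfDegree_le_standardEtale [IsNoetherianRing P] (hg : g.Monic)
    (S : Submonoid (AdjoinRoot g)) [IsLocalization S C]
    (hunit : IsUnit (algebraMap (AdjoinRoot g) C (AdjoinRoot.mk g (derivative g)))) (d : ℕ) :
    (cohomologyAnnihilatorOfDegree P (d + 1)).map (algebraMap P C) ≤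
      cohomologyAnnihilatorOfDegree C (d + 1) := by
  haveI : Module.Finite P (AdjoinRoot g) := hg.finite_adjoinRoot
  haveI : Module.Free P (AdjoinRoot g) := hg.free_adjoinRoot
  refine map_cohomologyAnnihilatorOfDegree_le_of_monogenic_of_isUnit (AdjoinRoot.root g) (g := g)
    (by rw [AdjoinRoot.aeval_eq, AdjoinRoot.mk_self]) (exists_eq_aeval_root g) S ?_ d
  rwa [AdjoinRoot.aeval_eq]

/-- **(SE-2), elementwise (OURS):** `c ∈ caᵈ⁺¹(P) ⟹ c ∈ caᵈ⁺¹(C)` in the standard-étale setting.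
[OURS · L1 w44b · w44b-o5] -/
theorem algebraMap_mem_cohomologyAnnihilatorOfDegree_standardEtale [IsNoetherianRing P]
    (hg : g.Monic) (S : Submonoid (AdjoinRoot g)) [IsLocalization S C]
    (hunit : IsUnit (algebraMap (AdjoinRoot g) C (AdjoinRoot.mk g (derivative g)))) {d : ℕ} {c : P}
    (hc : c ∈ cohomologyAnnihilatorOfDegree P (d + 1)) :
    algebraMap P C c ∈ cohomologyAnnihilatorOfDegree C (d + 1) :=
  map_cohomologyAnnihilatorOfDegree_le_standardEtale hg S hunit d (Ideal.mem_map_of_mem _ hc)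

/-- **(SE-3) standard-étale ascent of the full cohomology annihilator (OURS):** `ca(P) C ⊆ ca(C)`.
[OURS · L1 w44b · w44b-o5] -/
theorem map_cohomologyAnnihilator_le_standardEtale [IsNoetherianRing P] (hg : g.Monic)
    (S : Submonoid (AdjoinRoot g)) [IsLocalization S C]
    (hunit : IsUnit (algebraMap (AdjoinRoot g) C (AdjoinRoot.mk g (derivative g)))) :
    (cohomologyAnnihilator P).map (algebraMap P C) ≤ cohomologyAnnihilator C :=
  map_cohomologyAnnihilator_le_of_forall_succ
    (map_cohomologyAnnihilatorOfDegree_le_standardEtale hg S hunit)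

end AdjoinRoot

/-! ## (SE-4) Mathlib's standard-étale algebras `StandardEtalePair.Ring` / `Algebra.IsStandardEtale` -/

section IsStandardEtale

variable {P : Type u} [CommRing P]

/-- In `(P[X]/(f))[1/g]` for a Mathlib `StandardEtalePair` `(f, g)` (`f` monic, `f'·p₁ + f·p₂ = gⁿ`),
the image of `f'(root)` is a unit: Mathlib's `StandardEtalePair.HasMap.isUnit_derivative_f` at the
point `root f ∈ (P[X]/(f))[1/g]`. [folklore] -/
theorem isUnit_algebraMap_mk_derivative (Q : StandardEtalePair P) :
    IsUnit (algebraMap (AdjoinRoot Q.f) (Localization.Away (AdjoinRoot.mk Q.f Q.g))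
      (AdjoinRoot.mk Q.f (derivative Q.f))) := by
  set x : Localization.Away (AdjoinRoot.mk Q.f Q.g) :=
    algebraMap (AdjoinRoot Q.f) _ (AdjoinRoot.root Q.f) with hx
  have hmap : Q.HasMap x := by
    refine ⟨?_, ?_⟩
    · rw [hx, Polynomial.aeval_algebraMap_apply, AdjoinRoot.aeval_eq, AdjoinRoot.mk_self, map_zero]
    · rw [hx, Polynomial.aeval_algebraMap_apply, AdjoinRoot.aeval_eq]
      exact IsLocalization.Away.algebraMap_isUnit ..
  have h := StandardEtalePair.HasMap.isUnit_derivative_f Q hmap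
  rwa [hx, Polynomial.aeval_algebraMap_apply, AdjoinRoot.aeval_eq] at h

/-- **(SE-4) for a `StandardEtalePair` (OURS):** for `P` noetherian and Mathlib's standard-étale algebra
`Q.Ring = P[X][Y]/(f, Yg − 1)` of a pair `Q = (f, g)`, `caᵈ⁺¹(P) Q.Ring ⊆ caᵈ⁺¹(Q.Ring)` — via
Mathlib's `Q.equivAwayAdjoinRoot : Q.Ring ≃ₐ[P] (P[X]/(f))[1/g]` and (SE-2).
[OURS · L1 w44b · w44b-o5] -/
theorem map_cohomologyAnnihilatorOfDegree_le_standardEtalePair [IsNoetherianRing P]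
    (Q : StandardEtalePair P) (d : ℕ) :
    (cohomologyAnnihilatorOfDegree P (d + 1)).map (algebraMap P Q.Ring) ≤
      cohomologyAnnihilatorOfDegree Q.Ring (d + 1) :=
  map_cohomologyAnnihilatorOfDegree_le_of_algEquiv Q.equivAwayAdjoinRoot
    (map_cohomologyAnnihilatorOfDegree_le_standardEtale Q.monic_f
      (Submonoid.powers (AdjoinRoot.mk Q.f Q.g)) (isUnit_algebraMap_mk_derivative Q) d)

variable (P) (S : Type u) [CommRing S] [Algebra P S]

/-- **(SE-4) (OURS).** For `P` noetherian and `S` a STANDARD ÉTALE `P`-algebra in Mathlib's sense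
(`Algebra.IsStandardEtale P S`: `S ≃ₐ[P] P[X][Y]/(f, Yg − 1)`, `f` monic, `f'` invertible):
`caᵈ⁺¹(P) S ⊆ caᵈ⁺¹(S)` for every `d` (same index). [OURS · L1 w44b · w44b-o5] -/
theorem map_cohomologyAnnihilatorOfDegree_le_of_isStandardEtale [IsNoetherianRing P]
    [Algebra.IsStandardEtale P S] (d : ℕ) :
    (cohomologyAnnihilatorOfDegree P (d + 1)).map (algebraMap P S) ≤
      cohomologyAnnihilatorOfDegree S (d + 1) := by
  obtain ⟨Q⟩ := (inferInstance : Algebra.IsStandardEtale P S).nonempty_standardEtalePresentation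
  exact map_cohomologyAnnihilatorOfDegree_le_of_algEquiv Q.equivRing
    (map_cohomologyAnnihilatorOfDegree_le_standardEtalePair Q.P d)

/-- **(SE-4), elementwise (OURS):** `c ∈ caᵈ⁺¹(P) ⟹ c ∈ caᵈ⁺¹(S)` for `S` standard étale over
noetherian `P`. [OURS · L1 w44b · w44b-o5] -/
theorem algebraMap_mem_cohomologyAnnihilatorOfDegree_of_isStandardEtale [IsNoetherianRing P]
    [Algebra.IsStandardEtale P S] {d : ℕ} {c : P} (hc : c ∈ cohomologyAnnihilatorOfDegree P (d + 1)) :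
    algebraMap P S c ∈ cohomologyAnnihilatorOfDegree S (d + 1) :=
  map_cohomologyAnnihilatorOfDegree_le_of_isStandardEtale P S d (Ideal.mem_map_of_mem _ hc)

/-- **(SE-3) for standard-étale algebras (OURS):** `ca(P) S ⊆ ca(S)`. [OURS · L1 w44b · w44b-o5] -/
theorem map_cohomologyAnnihilator_le_of_isStandardEtale [IsNoetherianRing P]
    [Algebra.IsStandardEtale P S] :
    (cohomologyAnnihilator P).map (algebraMap P S) ≤ cohomologyAnnihilator S :=
  map_cohomologyAnnihilator_le_of_forall_succ (map_cohomologyAnnihilatorOfDegree_le_of_isStandardEtale P S)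

end IsStandardEtale

/-! ## (SE-5) Étale algebras and étale neighbourhoods -/

section Etale

variable (P : Type u) [CommRing P] (S : Type u) [CommRing S] [Algebra P S]

/-- An étale algebra is étale at every prime (formal étaleness is stable under localisation and
composition). [folklore] -/
theorem isEtaleAt_of_etale [Algebra.Etale P S] (𝔮 : Ideal S) [𝔮.IsPrime] : Algebra.IsEtaleAt P 𝔮 := by
  unfold Algebra.IsEtaleAt
  haveI : Algebra.FormallyEtale S (Localization.AtPrime 𝔮) :=
    Algebra.FormallyEtale.of_isLocalization 𝔮.primeCompl
  exact Algebra.FormallyEtale.comp P S _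

/-- **(SE-5), localised at a prime (OURS).** For `S` étale over noetherian `P`, a prime `𝔮` of `S`
and `c ∈ caᵈ⁺¹(P)`: the image of `c` in `S_𝔮` lies in `caᵈ⁺¹(S_𝔮)`. Proof: by Mathlib's local
structure theorem (`Algebra.IsEtaleAt.exists_isStandardEtale`, Stacks 00UE) some `S[1/f]`, `f ∉ 𝔮`, is
standard étale over `P`; (SE-4) puts `c` in `caᵈ⁺¹(S[1/f])`, and `S_𝔮` is a localisation of the
noetherian ring `S[1/f]` ([IyengarTakahashi2014, 2.10(1)]). [OURS · L1 w44b · w44b-o5] -/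
theorem algebraMap_mem_cohomologyAnnihilatorOfDegree_atPrime_of_etale [IsNoetherianRing P]
    [Algebra.Etale P S] (𝔮 : Ideal S) [𝔮.IsPrime] {d : ℕ} {c : P}
    (hc : c ∈ cohomologyAnnihilatorOfDegree P (d + 1)) :
    algebraMap P (Localization.AtPrime 𝔮) c ∈
      cohomologyAnnihilatorOfDegree (Localization.AtPrime 𝔮) (d + 1) := by
  haveI : IsNoetherianRing S := Algebra.FiniteType.isNoetherianRing P S
  haveI := isEtaleAt_of_etale P S 𝔮
  obtain ⟨f, hf𝔮, hstd⟩ := Algebra.IsEtaleAt.exists_isStandardEtale (R := P) 𝔮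
  -- `S_𝔮` as a localisation of `S_f := S[1/f]`
  have hle : Submonoid.powers f ≤ 𝔮.primeCompl := Submonoid.powers_le.mpr hf𝔮
  letI : Algebra (Localization.Away f) (Localization.AtPrime 𝔮) :=
    IsLocalization.localizationAlgebraOfSubmonoidLe (Localization.Away f) (Localization.AtPrime 𝔮)
      (Submonoid.powers f) 𝔮.primeCompl hle
  haveI hT : IsScalarTower S (Localization.Away f) (Localization.AtPrime 𝔮) :=
    IsLocalization.localization_isScalarTower_of_submonoid_le (Localization.Away f)
      (Localization.AtPrime 𝔮) (Submonoid.powers f) 𝔮.primeCompl hle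
  haveI : IsLocalization (𝔮.primeCompl.map (algebraMap S (Localization.Away f)))
      (Localization.AtPrime 𝔮) :=
    IsLocalization.isLocalization_of_submonoid_le (Localization.Away f) (Localization.AtPrime 𝔮)
      (Submonoid.powers f) 𝔮.primeCompl hle
  haveI : IsNoetherianRing (Localization.Away f) :=
    IsLocalization.isNoetherianRing (Submonoid.powers f) _ inferInstance
  -- (SE-4) on `S[1/f]`, then localise
  have h1 : algebraMap P (Localization.Away f) c ∈
      cohomologyAnnihilatorOfDegree (Localization.Away f) (d + 1) :=
    algebraMap_mem_cohomologyAnnihilatorOfDegree_of_isStandardEtale P (Localization.Away f) hc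
  have h2 := map_cohomologyAnnihilatorOfDegree_le_of_isLocalization
    (𝔮.primeCompl.map (algebraMap S (Localization.Away f))) (Localization.AtPrime 𝔮) (d + 1)
    (Ideal.mem_map_of_mem (algebraMap (Localization.Away f) (Localization.AtPrime 𝔮)) h1)
  rwa [IsScalarTower.algebraMap_apply P S (Localization.Away f),
    ← IsScalarTower.algebraMap_apply S (Localization.Away f) (Localization.AtPrime 𝔮),
    ← IsScalarTower.algebraMap_apply P S (Localization.AtPrime 𝔮)] at h2

/-- **(SE-5) ÉTALE ASCENT WITH THE SAME INDEX (OURS).** For `S` étale over the noetherian ring `P`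
(`Algebra.Etale P S`: formally étale and finitely presented): `caᵈ⁺¹(P) S ⊆ caᵈ⁺¹(S)` for every `d`.
Membership in `caᵈ⁺¹(S)` is tested at the maximal ideals of `S` with the same index (tree
`mem_cohomologyAnnihilatorOfDegree_of_forall_isMaximal`), where the previous theorem applies.
[OURS · L1 w44b · w44b-o5] -/
theorem map_cohomologyAnnihilatorOfDegree_le_of_etale [IsNoetherianRing P] [Algebra.Etale P S]
    (d : ℕ) :
    (cohomologyAnnihilatorOfDegree P (d + 1)).map (algebraMap P S) ≤
      cohomologyAnnihilatorOfDegree S (d + 1) := by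
  haveI : IsNoetherianRing S := Algebra.FiniteType.isNoetherianRing P S
  rw [Ideal.map_le_iff_le_comap]
  intro c hc
  rw [Ideal.mem_comap]
  refine mem_cohomologyAnnihilatorOfDegree_of_forall_isMaximal _ (d + 1) fun 𝔪 _ => ?_
  rw [← IsScalarTower.algebraMap_apply]
  exact algebraMap_mem_cohomologyAnnihilatorOfDegree_atPrime_of_etale P S 𝔪 hc

/-- **(SE-5), elementwise (OURS):** `c ∈ caᵈ⁺¹(P) ⟹ c ∈ caᵈ⁺¹(S)` for `S` étale over noetherian
`P`. [OURS · L1 w44b · w44b-o5] -/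
theorem algebraMap_mem_cohomologyAnnihilatorOfDegree_of_etale [IsNoetherianRing P]
    [Algebra.Etale P S] {d : ℕ} {c : P} (hc : c ∈ cohomologyAnnihilatorOfDegree P (d + 1)) :
    algebraMap P S c ∈ cohomologyAnnihilatorOfDegree S (d + 1) :=
  map_cohomologyAnnihilatorOfDegree_le_of_etale P S d (Ideal.mem_map_of_mem _ hc)

/-- **(SE-5), all degrees (OURS):** `caⁿ(P) S ⊆ caⁿ(S)` for every `n`, `S` étale over noetherian `P`.
[OURS · L1 w44b · w44b-o5] -/
theorem map_cohomologyAnnihilatorOfDegree_le_of_etale' [IsNoetherianRing P] [Algebra.Etale P S]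
    (n : ℕ) :
    (cohomologyAnnihilatorOfDegree P n).map (algebraMap P S) ≤ cohomologyAnnihilatorOfDegree S n :=
  map_cohomologyAnnihilatorOfDegree_le_of_forall_succ (map_cohomologyAnnihilatorOfDegree_le_of_etale P S) n

/-- **(SE-3) for étale algebras (OURS):** `ca(P) S ⊆ ca(S)`, `S` étale over noetherian `P`.
[OURS · L1 w44b · w44b-o5] -/
theorem map_cohomologyAnnihilator_le_of_etale [IsNoetherianRing P] [Algebra.Etale P S] :
    (cohomologyAnnihilator P).map (algebraMap P S) ≤ cohomologyAnnihilator S :=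
  map_cohomologyAnnihilator_le_of_forall_succ (map_cohomologyAnnihilatorOfDegree_le_of_etale P S)

variable (S' : Type u) [CommRing S'] [Algebra S S'] [Algebra P S'] [IsScalarTower P S S']

/-- **(SE-5) ÉTALE NEIGHBOURHOODS (OURS).** For `S` étale over noetherian `P` and `S'` ANY
localisation of `S` (`IsLocalization U S'`; e.g. an étale neighbourhood `P → S_𝔮`):
`caᵈ⁺¹(P) S' ⊆ caᵈ⁺¹(S')` for every `d` — (SE-5) followed by [IyengarTakahashi2014, Lemma 2.10(1)]
(tree `map_cohomologyAnnihilatorOfDegree_le_of_isLocalization`). This is step (2.2) of idea-2's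
ROUND4-ASCENT; the henselisation (2.3) is the filtered colimit of these and is not treated here.
[OURS · L1 w44b · w44b-o5] -/
theorem map_cohomologyAnnihilatorOfDegree_le_of_isLocalization_of_etale [IsNoetherianRing P]
    [Algebra.Etale P S] (U : Submonoid S) [IsLocalization U S'] (d : ℕ) :
    (cohomologyAnnihilatorOfDegree P (d + 1)).map (algebraMap P S') ≤
      cohomologyAnnihilatorOfDegree S' (d + 1) := by
  haveI : IsNoetherianRing S := Algebra.FiniteType.isNoetherianRing P S
  rw [IsScalarTower.algebraMap_eq P S S', ← Ideal.map_map]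
  exact (Ideal.map_mono (map_cohomologyAnnihilatorOfDegree_le_of_etale P S d)).trans
    (map_cohomologyAnnihilatorOfDegree_le_of_isLocalization U S' (d + 1))

/-- **(SE-3) for étale neighbourhoods (OURS):** `ca(P) S' ⊆ ca(S')` for `S'` a localisation of an
étale algebra over noetherian `P`. [OURS · L1 w44b · w44b-o5] -/
theorem map_cohomologyAnnihilator_le_of_isLocalization_of_etale [IsNoetherianRing P]
    [Algebra.Etale P S] (U : Submonoid S) [IsLocalization U S'] :
    (cohomologyAnnihilator P).map (algebraMap P S') ≤ cohomologyAnnihilator S' :=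
  map_cohomologyAnnihilator_le_of_forall_succ
    (map_cohomologyAnnihilatorOfDegree_le_of_isLocalization_of_etale P S S' U)

end Etale

end Summit.ResolutionOfSingularities.ResolutionOfSingularities.Theorems.HomologicalConductor.PersistenceStandardEtaleAscent

end
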